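import Summits.ResolutionOfSingularities.ResolutionOfSingularities.Theorems.WeightedInvariantLocalWeightedDropWildPurePowerFlagDropZeroMore

/-!
# `LocalWeightedDrop`, piece S3πM: [HP24, Prop. 4] case (i)/(iii) at `t = 0` in the shape of `DropZeroStatement` (branch `d_res ≥ q`)

Crux item stmt-ResolutionOfSingularities-8899 `LocalWeightedDrop`, class stub S3πM; sub-target `PurePowerFlag.DropZeroStatement` of
res-L1-w43-stub-1's split (STATUS 06:59:31Z): the witness is a FIRST-ORIENTATION flag `f` of the parent, and NO non-terminality of the
parent is assumed — only of the child.  [OURS · L1 W4.3, chain w43, seat res-D-pv-058 acting as res-L1-w43-stub-6; printed mathematics: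
Hauser–Perlega, PRIMS 60 (2024) Prop. 4 proof cases (i), (iii), pp. 794–795; not a statement of any manuscript.]

* `succE 0 E` contains `x`, and contains `y` iff `E` does (`zero_mem_succE_zero`, `one_mem_succE_zero_iff`);
* **hidden monomial along the zero shift**, any `E` (`termSub_of_sFlag_zero_eq_top`): `sFlag q C E 0 = ⊤` with `d_res ≥ q ≥ 1` forces
  `C = x^{r_x} y^{r_y + d}·unit`, a terminal shape;
* **DropZeroStatement, `n = 0` child flags, both orientations, branch `d_res(B) ≥ q`** (`exists_flag_gt_of_isN0_stepZero`,
  `exists_flag_gt_of_isN0_swap_stepZero`): witness `f = X·g` (first orientation; `g = 0` when `y` is exceptional) resp. `f = 0`;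
* **DropZeroStatement, tangent child flags of the first orientation** (`exists_flag_gt_of_isTangent_stepZero`): witness `f = X·g`.
What is NOT here: the companion branch `0 < d_res < q`; child tangent flags of the second orientation (InvN1 / case (iv)).
-/

set_option linter.dupNamespace false -- mandated namespace of this single-conjunct summit

namespace Summit.ResolutionOfSingularities.ResolutionOfSingularities.Theorems

open Literature.AlgebraicGeometry.Resolution
open Literature.AlgebraicGeometry.Resolution.HauserPerlega2024

namespace PurePowerFlag

open MvPowerSeries

variable {k : Type} [Field k]

/-- the exponent `x^a y^b` at `0`. -/
private theorem h_l (a b : ℕ) : (Finsupp.single (0 : Fin 2) a + Finsupp.single (1 : Fin 2) b : Fin 2 →₀ ℕ) 0 = a := by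
  rw [Finsupp.add_apply, Finsupp.single_eq_same, Finsupp.single_apply, if_neg (by decide), add_zero]

/-- the exponent `x^a y^b` at `1`. -/
private theorem h_r (a b : ℕ) : (Finsupp.single (0 : Fin 2) a + Finsupp.single (1 : Fin 2) b : Fin 2 →₀ ℕ) 1 = b := by
  rw [Finsupp.add_apply, Finsupp.single_eq_same, Finsupp.single_apply, if_neg (by decide), zero_add]

/-- an exponent on two letters is `x^{m 0} y^{m 1}`. -/
private theorem h_ssa (m : Fin 2 →₀ ℕ) : m = Finsupp.single 0 (m 0) + Finsupp.single 1 (m 1) := by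
  ext l
  rcases fin_two_cases l with rfl | rfl
  · rw [h_l]
  · rw [h_r]

/-- the degree on two letters. -/
private theorem h_deg (m : Fin 2 →₀ ℕ) : m.degree = m 0 + m 1 := by
  rw [Finsupp.degree_eq_sum, Fin.sum_univ_two]

/-- `s_𝓕` (branch `d_res ≥ q` or `d_res = 0`) as the minimum over the rows of the residual factor. -/
private theorem sFlag_eq_inf₃ (q : ℕ) (C : MvPowerSeries (Fin 2) k) (E : Finset (Fin 2)) (h : PowerSeries k)
    (hq : q ≤ dRes C E ∨ dRes C E = 0) :
    sFlag q C E h = (Finset.range (dRes C E)).inf fun i =>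
      (((dRes C E).factorial / (dRes C E - i) : ℕ) : ℕ∞) *
        (PowerSeries.mk fun a => coeff (Finsupp.single 0 a + Finsupp.single 1 i) (residual q C E h)).order := by
  unfold sFlag
  rw [if_pos hq]
  unfold coeffIdealOrder
  rw [← Finset.inf_eq_iInf]
  exact Finset.inf_congr rfl fun i _ => by rw [rowOrder_eq_order_mk]

/-- the order bound `r_x + r_y + d_res ≤ deg`. -/
private theorem exc_dRes_le {B : MvPowerSeries (Fin 2) k} (hB : B ≠ 0) (E : Finset (Fin 2)) {m : Fin 2 →₀ ℕ}
    (hm : coeff m B ≠ 0) : excExp B E 0 + excExp B E 1 + dRes B E ≤ m 0 + m 1 := by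
  rw [← order_toNat_eq_excExp_add_dRes hB E]
  have h1 := MvPowerSeries.order_le hm
  rw [← (MvPowerSeries.ne_zero_iff_order_finite).mp hB, h_deg] at h1
  exact_mod_cast h1

/-- a monomial of degree exactly `r_x + r_y + d_res`. -/
private theorem exists_deg_eq₃ {B : MvPowerSeries (Fin 2) k} (hB : B ≠ 0) (E : Finset (Fin 2)) :
    ∃ m, coeff m B ≠ 0 ∧ m 0 + m 1 = excExp B E 0 + excExp B E 1 + dRes B E := by
  obtain ⟨m₀, hm₀, hdeg⟩ := MvPowerSeries.exists_coeff_ne_zero_and_order ((MvPowerSeries.ne_zero_iff_order_finite).mp hB)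
  refine ⟨m₀, hm₀, ?_⟩
  rw [← order_toNat_eq_excExp_add_dRes hB E]
  have h2 : ((m₀ 0 + m₀ 1 : ℕ) : ℕ∞) = (B.order.toNat : ℕ∞) := by
    rw [← h_deg, hdeg, (MvPowerSeries.ne_zero_iff_order_finite).mp hB]
  exact_mod_cast h2

/-! ### The successor letters `succE 0 E` -/

/-- `x` is exceptional after the axis step. -/
theorem zero_mem_succE_zero (E : Finset (Fin 2)) : (0 : Fin 2) ∈ succE (0 : k) E := by
  unfold succE
  split_ifs <;> simp

/-- `y` stays exceptional after the axis step iff it was. -/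
theorem one_mem_succE_zero_iff (E : Finset (Fin 2)) : (1 : Fin 2) ∈ succE (0 : k) E ↔ (1 : Fin 2) ∈ E := by
  unfold succE
  by_cases h : (1 : Fin 2) ∈ E
  · rw [if_pos ⟨rfl, h⟩]; simp [h]
  · rw [if_neg (fun hc => h hc.2)]; simp [h]

/-! ### The hidden monomial along the zero shift (any `E`) -/

/-- **`sFlag q C E 0 = ⊤` with `d_res ≥ q ≥ 1` is a hidden MONOMIAL CASE**: the rows `i < d` of `G = C/(x^{r_x}y^{r_y})` vanish, the corner
`c_d y^d` survives, so `C = x^{r_x} y^{r_y + d}·unit` and the position is terminal. [HP24 Prop. 3 proof p. 792 l. 31–40] -/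
theorem termSub_of_sFlag_zero_eq_top (q : ℕ) {C : MvPowerSeries (Fin 2) k} (hC : cleanSeries q C = C) (hC0 : C ≠ 0)
    {E : Finset (Fin 2)} (hq : q ≤ dRes C E) (htop : sFlag q C E 0 = ⊤) : TermSub q C := by
  classical
  set rx := excExp C E 0 with hrx
  set ry := excExp C E 1 with hry
  set d := dRes C E with hdd
  set R : ℕ → PowerSeries k := fun j => PowerSeries.mk fun v =>
    coeff (Finsupp.single 0 (rx + v) + Finsupp.single 1 (ry + j)) C with hRdef
  have hR : ∀ j v, PowerSeries.coeff v (R j) = coeff (Finsupp.single 0 (rx + v) + Finsupp.single 1 (ry + j)) C :=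
    fun j v => by rw [hRdef, PowerSeries.coeff_mk]
  rw [sFlag_eq_inf₃ q C E 0 (Or.inl hq)] at htop
  have htop' : (Finset.range d).inf (fun i => ((d.factorial / (d - i) : ℕ) : ℕ∞) * (R i).order) = ⊤ := by
    rw [← htop]
    refine Finset.inf_congr rfl fun i _ => ?_
    congr 2
    ext v
    rw [hR, coeff_row_residual_zero q hC E]
  have hzero := rows_eq_zero_of_inf_eq_top R htop'
  have hn : ∀ m, coeff m C ≠ 0 → Finsupp.single 0 rx + Finsupp.single 1 ry ≤ m := fun m hm => by
    have := excExp_le_of_coeff_ne_zero C E hm; rwa [h_ssa (excExp C E)] at this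
  obtain ⟨i, a, hia, hsum⟩ := rows_xy_exists_degree_eq 0 1 zero_ne_one_fin fin_two_cases C rx ry d hn (exists_deg_eq₃ hC0 E) R hR
  have hid : i = d := by
    by_contra hne
    have := hzero i (by omega)
    rw [this, map_zero] at hia
    exact hia rfl
  have ha : a = 0 := by omega
  rw [hid, ha, hR, Nat.add_zero] at hia
  set n₀ : Fin 2 →₀ ℕ := Finsupp.single 0 rx + Finsupp.single 1 (ry + d) with hn₀
  have hn₀le : ∀ m, coeff m C ≠ 0 → n₀ ≤ m := by
    intro m hm l
    have hle := hn m hm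
    rcases fin_two_cases l with rfl | rfl
    · rw [hn₀, h_l]; have := hle 0; rwa [h_l] at this
    · rw [hn₀, h_r]
      have h1 := hle 1
      rw [h_r] at h1
      by_contra hlt
      push Not at hlt
      have hrow := hzero (m 1 - ry) (by omega)
      have : PowerSeries.coeff (m 0 - rx) (R (m 1 - ry)) = 0 := by rw [hrow, map_zero]
      rw [hR, show rx + (m 0 - rx) = m 0 by have := hle 0; rw [h_l] at this; omega,
        show ry + (m 1 - ry) = m 1 by omega, ← h_ssa m] at this
      exact hm this
  refine ⟨false, 0, map_zero _, Or.inl ⟨rx, ry + d, divMonomial n₀ C, ?_, ?_, ?_⟩⟩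
  · rw [← coeff_zero_eq_constantCoeff_apply]
    show coeff (0 + n₀) C ≠ 0
    rw [zero_add]; exact hia
  · have h2 := (coeff_cleanSeries_of_ne_zero q C n₀ (by rw [hC]; exact hia)).2
    intro hdvd; apply h2; intro l
    rcases fin_two_cases l with rfl | rfl
    · rw [hn₀, h_l]; exact hdvd.1
    · rw [hn₀, h_r]; exact hdvd.2
  · rw [orient_false, expansion_zero, hC, X_pow_eq, X_pow_eq, monomial_mul_monomial, one_mul, ← hn₀,
      monomial_mul_divMonomial n₀ C hn₀le]

/-! ### DropZeroStatement-shaped conclusions (witness: a first-orientation flag of the parent) -/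

/-- **[HP24, Prop. 4 (i)], child flag `V(z₁, y + g(x))`, branch `d_res ≥ q ≥ 1`**: for the axis successor `X 0 ^ q · T = B(x,xy)` of a
clean `B ≠ 0` with `q ≤ ord B`, NOT assuming the parent non-terminal but the child, every `n = 0` flag `g` of `(T, E′)` is strictly
dominated by the parent flag `X·g` (`g = 0` when `y` is exceptional): `flagTriple q T E′ g < flagTriple q B E (X·g)`.
[HP24 Prop. 4 (i) p. 794 l. 22 – p. 795 l. 5] -/
theorem exists_flag_gt_of_isN0_stepZero (p : ℕ) [Fact p.Prime] [CharP k p] {e : ℕ} {B T : MvPowerSeries (Fin 2) k}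
    (hB : cleanSeries (p ^ e) B = B)
    (hB0 : B ≠ 0) (hqo : ((p ^ e : ℕ) : ℕ∞) ≤ B.order)
    (hT : (X 0 : MvPowerSeries (Fin 2) k) ^ (p ^ e) * T = subst (PlaneGerm.dirChart (0 : k)) B) {E E' : Finset (Fin 2)}
    (h0 : (0 : Fin 2) ∈ E') (h1 : (1 : Fin 2) ∈ E' ↔ (1 : Fin 2) ∈ E) (hq : p ^ e ≤ dRes B E) (hntT : ¬ TermSub (p ^ e) T)
    (g : PowerSeries k) (hg : PowerSeries.constantCoeff g = 0) (hN : IsN0 E' g) :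
    ∃ f : PowerSeries k, PowerSeries.constantCoeff f = 0 ∧ (IsN0 E f ∨ IsTangent E f) ∧
      flagTriple (p ^ e) T E' g < flagTriple (p ^ e) B E f := by
  classical
  have hTc := cleanSeries_of_stepZero (p ^ e) hB hT
  have hT0 := ne_zero_stepZero (p ^ e) hB0 hT
  have hXg : PowerSeries.constantCoeff (PowerSeries.X * g) = 0 := by rw [map_mul, PowerSeries.constantCoeff_X, zero_mul]
  have hNf : IsN0 E (PowerSeries.X * g) := by
    rcases hN with h1' | hg0
    · exact Or.inl (fun hm => h1' (h1.mpr hm))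
    · exact Or.inr (by rw [hg0, mul_zero])
  refine ⟨PowerSeries.X * g, hXg, Or.inl hNf, ?_⟩
  rw [flagTriple_of_isN0 (p ^ e) T hN, flagTriple_of_isN0 (p ^ e) B hNf, Prod.Lex.toLex_lt_toLex]
  rcases (dRes_stepZero_le (p ^ e) hB0 hqo hT h0 h1).lt_or_eq with hlt | heq
  · left; exact hlt
  · right
    refine ⟨heq, ?_⟩
    rw [Prod.Lex.toLex_lt_toLex]
    right
    refine ⟨rfl, ?_⟩
    show sFlag (p ^ e) T E' g < sFlag (p ^ e) B E (PowerSeries.X * g)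
    -- the identity `s′ + d! = s(X·g)` in the two cases `y ∉ E` / `y ∈ E`
    have hadd : sFlag (p ^ e) T E' g + ((dRes B E).factorial : ℕ∞) = sFlag (p ^ e) B E (PowerSeries.X * g) := by
      by_cases hy : (1 : Fin 2) ∈ E
      · have hg0 : g = 0 := hN.resolve_left (fun hm => hm (h1.mpr hy))
        subst hg0
        rw [mul_zero]
        exact sFlag_stepZero_zero_add_factorial (p ^ e) hB hB0 hqo hT h0 h1 hq heq
      · exact sFlag_stepZero_add_factorial (p ^ e) hB0 hqo hT h0 hy (fun hm => hy (h1.mp hm)) hq heq g hg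
    -- `s′` is finite: otherwise the child is a hidden monomial
    have hfin : sFlag (p ^ e) T E' g ≠ ⊤ := by
      intro htop
      apply hntT
      by_cases hy : (1 : Fin 2) ∈ E
      · have hg0 : g = 0 := hN.resolve_left (fun hm => hm (h1.mpr hy))
        subst hg0
        exact termSub_of_sFlag_zero_eq_top (p ^ e) hTc hT0 (by rw [heq]; exact hq) htop
      · -- `y ∉ E′`: the series-level hidden monomial along the shift `g`
        have hp : ∀ m, coeff m T ≠ 0 → excExp T E' 0 ≤ m 0 := fun m hm => excExp_le_of_coeff_ne_zero T E' hm 0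
        have hry' : excExp T E' 1 = 0 := by rw [excExp_apply, if_neg (fun hm => hy (h1.mp hm))]
        have hmin : ∀ m, coeff m T ≠ 0 → excExp T E' 0 + dRes T E' ≤ m 0 + m 1 := fun m hm => by
          have := exc_dRes_le hT0 E' hm; rw [hry'] at this; omega
        have hex : ∃ m, coeff m (cleanSeries (p ^ e) T) ≠ 0 ∧ m 0 + m 1 = excExp T E' 0 + dRes T E' := by
          obtain ⟨m, hm, hdeg⟩ := exists_deg_eq₃ hT0 E'
          exact ⟨m, by rw [hTc]; exact hm, by rw [hry'] at hdeg; omega⟩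
        rw [sFlag_eq_inf₃ (p ^ e) T E' g (Or.inl (by rw [heq]; exact hq))] at htop
        have hrows : ∀ j v, PowerSeries.coeff v (PowerSeries.mk fun a => coeff (Finsupp.single 0 a + Finsupp.single 1 j)
            (residual (p ^ e) T E' g)) = coeff (Finsupp.single 0 (excExp T E' 0 + v) + Finsupp.single 1 j)
            (cleanSeries (p ^ e) (subst (fun l : Fin 2 => if l = (1 : Fin 2) then (X 1 : MvPowerSeries (Fin 2) k) +
              PowerSeries.subst (X 0 : MvPowerSeries (Fin 2) k) g else X l) T)) := by
          intro j v
          rw [PowerSeries.coeff_mk]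
          unfold residual
          show coeff (Finsupp.single (0 : Fin 2) v + Finsupp.single 1 j + excExp T E') (expansion (p ^ e) T g) = _
          rw [show Finsupp.single (0 : Fin 2) v + Finsupp.single 1 j + excExp T E' =
              Finsupp.single 0 (excExp T E' 0 + v) + Finsupp.single 1 j by
            ext l
            rcases fin_two_cases l with rfl | rfl
            · rw [Finsupp.add_apply, h_l, h_l, add_comm]
            · rw [Finsupp.add_apply, h_r, h_r, hry', add_zero]]
          unfold expansion
          rw [shift_eq]
        obtain ⟨u, hfac, hu, hndvd⟩ := exists_eq_monomial_mul_of_inf_rows_eq_top p 0 1 zero_ne_one_fin fin_two_cases T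
          (excExp T E' 0) (dRes T E') hp hmin hex g hg _ hrows htop
        exact ⟨false, g, hg, Or.inl ⟨excExp T E' 0, dRes T E', u, hu, hndvd, by
          rw [orient_false]; unfold expansion; rw [shift_eq, hfac, X_pow_eq, X_pow_eq, monomial_mul_monomial, one_mul]⟩⟩
    obtain ⟨n, hn⟩ := ENat.ne_top_iff_exists.mp hfin
    rw [← hadd, ← hn]
    calc ((n : ℕ) : ℕ∞) < ((n + (dRes B E).factorial : ℕ) : ℕ∞) := by
          rw [Nat.cast_lt]; have := Nat.factorial_pos (dRes B E); omega
      _ = (n : ℕ∞) + ((dRes B E).factorial : ℕ∞) := by rw [Nat.cast_add]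

/-- **[HP24, Prop. 4 (i)], child flag `V(z, x)` (second orientation, `g = 0` forced), branch `d_res ≥ q ≥ 1`**, DropZeroStatement shape:
witness the zero shift of the parent. [HP24 Prop. 4 (i) p. 794 l. 40–45] -/
theorem exists_flag_gt_of_isN0_swap_stepZero (q : ℕ) (hq1 : 1 ≤ q) {B T : MvPowerSeries (Fin 2) k} (hB : cleanSeries q B = B)
    (hB0 : B ≠ 0) (hqo : ((q : ℕ) : ℕ∞) ≤ B.order)
    (hT : (X 0 : MvPowerSeries (Fin 2) k) ^ q * T = subst (PlaneGerm.dirChart (0 : k)) B) {E E' : Finset (Fin 2)}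
    (h0 : (0 : Fin 2) ∈ E') (h1 : (1 : Fin 2) ∈ E' ↔ (1 : Fin 2) ∈ E) (hq : q ≤ dRes B E) (g : PowerSeries k)
    (hN : IsN0 (swapE E') g) :
    ∃ f : PowerSeries k, PowerSeries.constantCoeff f = 0 ∧ (IsN0 E f ∨ IsTangent E f) ∧
      flagTriple q (swap T) (swapE E') g < flagTriple q B E f := by
  have hh : g = 0 := hN.resolve_left (fun hne => hne ((mem_swapE E' 1).mpr (by rw [Equiv.swap_apply_right]; exact h0)))
  subst hh
  refine ⟨0, map_zero _, Or.inl (Or.inr rfl), ?_⟩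
  rw [flagTriple_of_isN0 q (swap T) hN, flagTriple_of_isN0 q B (Or.inr rfl), dRes_swap, Prod.Lex.toLex_lt_toLex]
  rcases (dRes_stepZero_le q hB0 hqo hT h0 h1).lt_or_eq with hlt' | heq
  · left; exact hlt'
  · right
    refine ⟨heq, ?_⟩
    rw [Prod.Lex.toLex_lt_toLex]
    right
    refine ⟨rfl, ?_⟩
    show sFlag q (swap T) (swapE E') 0 < sFlag q B E 0
    rw [sFlag_swap_stepZero_eq_factorial q hq1 hB hB0 hqo hT h0 h1 hq heq,
      ← sFlag_stepZero_zero_add_factorial q hB hB0 hqo hT h0 h1 hq heq]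
    have hfac := factorial_le_sFlag_stepZero_zero q hB hB0 hT hq heq (E := E) (E' := E')
    calc ((dRes B E).factorial : ℕ∞) < ((dRes B E).factorial : ℕ∞) + ((dRes B E).factorial : ℕ∞) := by
          rw [← Nat.cast_add, Nat.cast_lt]; have := Nat.factorial_pos (dRes B E); omega
      _ ≤ sFlag q T E' 0 + ((dRes B E).factorial : ℕ∞) := add_le_add hfac le_rfl

/-- **[HP24, Prop. 4 (iii)], child tangent flag `V(z₁, y + g(x))`**, DropZeroStatement shape: witness `X·g`. [HP24 Prop. 4 (iii) p. 795] -/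
theorem exists_flag_gt_of_isTangent_stepZero (q : ℕ) {B T : MvPowerSeries (Fin 2) k}
    (hT : (X 0 : MvPowerSeries (Fin 2) k) ^ q * T = subst (PlaneGerm.dirChart (0 : k)) B) {E E' : Finset (Fin 2)}
    (h1 : (1 : Fin 2) ∈ E' ↔ (1 : Fin 2) ∈ E) (g : PowerSeries k) (hg : PowerSeries.constantCoeff g = 0) (hTan : IsTangent E' g) :
    ∃ f : PowerSeries k, PowerSeries.constantCoeff f = 0 ∧ (IsN0 E f ∨ IsTangent E f) ∧
      flagTriple q T E' g < flagTriple q B E f := by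
  have hTan' := isTangent_X_mul h1 hg hTan
  refine ⟨PowerSeries.X * g, by rw [map_mul, PowerSeries.constantCoeff_X, zero_mul], Or.inr hTan', ?_⟩
  rw [flagTriple_of_not_isN0 q T hTan.not_isN0, flagTriple_of_not_isN0 q B hTan'.not_isN0, tangency_X_mul hTan.2.1,
    dFlag_stepZero_eq q hT g hg (tangency g), Prod.Lex.toLex_lt_toLex]
  right
  refine ⟨rfl, ?_⟩
  rw [Prod.Lex.toLex_lt_toLex]
  left
  exact Nat.lt_succ_self _

end PurePowerFlag

end Summit.ResolutionOfSingularities.ResolutionOfSingularities.Theorems
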